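import Mathlib
import Summits.CriticalPhenomena.PercolationContinuityZ3.Theorems.PercNearOneGluingNearOneGluingKnLemma3i
import Summits.CriticalPhenomena.PercolationContinuityZ3.Theorems.PercNearOneGluingNearOneGluingMaxattTwo
import Summits.CriticalPhenomena.PercolationContinuityZ3.Theorems.PercNearOneGluingNearOneGluingMaxattGlue
import Summits.CriticalPhenomena.PercolationContinuityZ3.Theorems.PercNearOneGluingNearOneGluingMaxattOfGl3
import HarnessLib

/-!
# GL3 when the source is reliable

Stub `stub_gl3OfReliableSource` of line `SketchR2I5` (cycle 4) for the crux `PercNearOneGluing.NearOneGluing`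
(item stmt-CriticalPhenomena-4574 = Kozma–Nitzan Conjecture 3 over all finite weighted graphs).

Setting: one finite weighted graph — vertices `Fin n`, weights `w`, `μ = prodBernoulli w` on bond
configurations `ω : Set (Sym2 (Fin n))`; a family of relays `A`, a source `o`, a target `b` and an outsider
`x`, all three outside `A`; `r(v) := μ(v ↔ b)`, `u(v) := μ(v ↮ b) = μ.real (openConn v b)ᶜ`; attachment events
`Att a := openConnIn (insert a (↑(insert x (insert b A)))ᶜ) o a` (an open `o–a` path avoiding `x`, `b` and the
other relays), `F := {∃ a ∈ A, Att a}`, and the lexicographic selection events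
`Sel a := Att a ∩ {every attached a' ∈ A has (u a', a') ≤ₗₑₓ (u a, a)}`.

THEOREM (`stub_gl3OfReliableSource`).  If `r(a) ≤ r(x)` on `A` and EITHER `r(x) ≤ r(o)` OR
`Σ_{a ∈ A} r(a) μ(Sel a) ≤ r(o) μ(F)`, then the generalized Kozma–Nitzan Lemma 3(i) inequality holds:
`μ(x ↔ b, F) − r(x) μ(F) ≤ μ(o ↔ b, F) − Σ_{a ∈ A} r(a) μ(Sel a)`.

Proof.
* `F` is increasing in the open edge cluster of `o` (`gl3OfReliableSource_mono_openEdgeCluster`: each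
  `Att a = {o ↔ a in S_a} = {a ↔ o in S_a}` is, by `maxattTwo_openConnIn_mono_openEdgeCluster`), so the landed
  Kozma–Nitzan Lemma 3(i) `knLemma3i` (`a₁ = x`, `a₂ = o`, `Q = F`) gives, for every `d ≥ 0` with
  `r(x) ≤ r(o) + d`, `μ(x ↔ b, F) ≤ μ(o ↔ b, F) + d μ(F)`.
* The selection events partition `F` (`maxattOfGl3_real_setOf_exists_eq_sum`), so
  `Σ_a r(a) μ(Sel a) ≤ r(x) Σ_a μ(Sel a) = r(x) μ(F)`.
* Arithmetic (`gl3OfReliableSource_arith`): if `r(x) ≤ r(o)` take `d = 0`; otherwise take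
  `d = r(x) − r(o)` and use the second disjunct.
-/

namespace Summit.CriticalPhenomena.PercolationContinuityZ3.Theorems

open MeasureTheory Set Literature.Probability.LatticeModels Literature.Probability.Percolation
open scoped Classical BigOperators

section Gl3OfReliableSource

/-- **Arithmetic core of `stub_gl3OfReliableSource`.**  Abstract reals: `r a ≤ rx` on `A`, `0 ≤ m a`,
`mF = Σ_a m a`, the Kozma–Nitzan Lemma 3(i) output `mBxF ≤ mBoF + d·mF` for every admissible `d`, and the
reliability disjunction `rx ≤ ro ∨ Σ_a r a · m a ≤ ro · mF` give `mBxF − rx·mF ≤ mBoF − Σ_a r a · m a`. -/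
theorem gl3OfReliableSource_arith {ι : Type*} (A : Finset ι) (r m : ι → ℝ) {rx ro mF mBxF mBoF : ℝ}
    (hdisj : rx ≤ ro ∨ ∑ a ∈ A, r a * m a ≤ ro * mF)
    (hrel : ∀ a ∈ A, r a ≤ rx) (hm : ∀ a, 0 ≤ m a) (hF : mF = ∑ a ∈ A, m a)
    (hkn : ∀ d : ℝ, 0 ≤ d → rx ≤ ro + d → mBxF ≤ mBoF + d * mF) :
    mBxF - rx * mF ≤ mBoF - ∑ a ∈ A, r a * m a := by
  have hS : ∑ a ∈ A, r a * m a ≤ rx * mF := by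
    calc ∑ a ∈ A, r a * m a ≤ ∑ a ∈ A, rx * m a :=
          Finset.sum_le_sum fun a ha => mul_le_mul_of_nonneg_right (hrel a ha) (hm a)
      _ = rx * mF := by rw [hF, Finset.mul_sum]
  rcases le_or_gt rx ro with hle | hlt
  · have h := hkn 0 le_rfl (by linarith)
    linarith
  · have h2 : ∑ a ∈ A, r a * m a ≤ ro * mF := hdisj.resolve_left (not_le.2 hlt)
    have h := hkn (rx - ro) (by linarith) (by linarith)
    have e : (rx - ro) * mF = rx * mF - ro * mF := by ring
    linarith

/-- **`{∃ a ∈ A, o ↔ a in S a}` is increasing in the open edge cluster of `o`** (hypothesis shape of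
`knLemma3i` with `a₂ = o`): each `{o ↔ a in S a} = {a ↔ o in S a}` is, by
`maxattTwo_openConnIn_mono_openEdgeCluster`. -/
theorem gl3OfReliableSource_mono_openEdgeCluster {V : Type*} (A : Finset V) (S : V → Set V) (o : V) :
    ∀ ω ω' : BondConfig V,
      ω ∈ {ω : BondConfig V | ∃ a ∈ A, ω ∈ (openConnIn (S a) o a : Set (BondConfig V))} →
      openEdgeCluster ω o ⊆ openEdgeCluster ω' o →
      ω' ∈ {ω : BondConfig V | ∃ a ∈ A, ω ∈ (openConnIn (S a) o a : Set (BondConfig V))} := by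
  intro ω ω' hω hsub
  obtain ⟨a, ha, hωa⟩ := hω
  have hsym : ∀ (T : Set V) (p q : V) (η : BondConfig V),
      η ∈ (openConnIn T p q : Set (BondConfig V)) → η ∈ (openConnIn T q p : Set (BondConfig V)) :=
    fun T p q η ⟨hp, hq, h⟩ => ⟨hq, hp, h.symm⟩
  exact ⟨a, ha, hsym _ _ _ _
    (maxattTwo_openConnIn_mono_openEdgeCluster (S a) a o ω ω' (hsym _ _ _ _ hωa) hsub)⟩

end Gl3OfReliableSource

/-- **GL3 holds when the source is reliable enough** (stub `stub_gl3OfReliableSource` of line `SketchR2I5`).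
With `r(v) = μ(v ↔ b)`, `F = {∃ a ∈ A, Att a}` and the lexicographic selection events `Sel a` (see the module
docstring): if `r(a) ≤ r(x)` on `A` and (`r(x) ≤ r(o)` or `Σ_a r(a) μ(Sel a) ≤ r(o) μ(F)`), then
`μ(x ↔ b, F) − r(x) μ(F) ≤ μ(o ↔ b, F) − Σ_{a ∈ A} r(a) μ(Sel a)`.  Kozma–Nitzan Lemma 3(i) (`knLemma3i`, with
`Q = F` increasing in the open edge cluster of `o`) plus the partition of `F` into the selection events. -/
theorem stub_gl3OfReliableSource :
    ∀ (n : ℕ) (w : Sym2 (Fin n) → unitInterval) (A : Finset (Fin n)) (o b x : Fin n), o ∉ A → b ∉ A → x ∉ A →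
      (∀ a ∈ A, (prodBernoulli w).real (openConn a b) ≤ (prodBernoulli w).real (openConn x b)) →
      ((prodBernoulli w).real (openConn x b) ≤ (prodBernoulli w).real (openConn o b) ∨
        ∑ a ∈ A, (prodBernoulli w).real (openConn a b) *
          (prodBernoulli w).real {ω | ω ∈ openConnIn (insert a ((↑(insert x (insert b A)) : Set (Fin n))ᶜ)) o a ∧
            ∀ a' ∈ A, ω ∈ openConnIn (insert a' ((↑(insert x (insert b A)) : Set (Fin n))ᶜ)) o a' →
              ((prodBernoulli w).real (openConn a' b)ᶜ < (prodBernoulli w).real (openConn a b)ᶜ ∨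
                ((prodBernoulli w).real (openConn a' b)ᶜ = (prodBernoulli w).real (openConn a b)ᶜ ∧ a' ≤ a))} ≤
          (prodBernoulli w).real (openConn o b) *
            (prodBernoulli w).real {ω | ∃ a ∈ A, ω ∈ openConnIn (insert a ((↑(insert x (insert b A)) : Set (Fin n))ᶜ)) o a}) →
      (prodBernoulli w).real (openConn x b ∩
          {ω | ∃ a ∈ A, ω ∈ openConnIn (insert a ((↑(insert x (insert b A)) : Set (Fin n))ᶜ)) o a}) -
        (prodBernoulli w).real (openConn x b) *
          (prodBernoulli w).real {ω | ∃ a ∈ A, ω ∈ openConnIn (insert a ((↑(insert x (insert b A)) : Set (Fin n))ᶜ)) o a} ≤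
      (prodBernoulli w).real (openConn o b ∩
          {ω | ∃ a ∈ A, ω ∈ openConnIn (insert a ((↑(insert x (insert b A)) : Set (Fin n))ᶜ)) o a}) -
        ∑ a ∈ A, (prodBernoulli w).real (openConn a b) *
          (prodBernoulli w).real {ω | ω ∈ openConnIn (insert a ((↑(insert x (insert b A)) : Set (Fin n))ᶜ)) o a ∧
            ∀ a' ∈ A, ω ∈ openConnIn (insert a' ((↑(insert x (insert b A)) : Set (Fin n))ᶜ)) o a' →
              ((prodBernoulli w).real (openConn a' b)ᶜ < (prodBernoulli w).real (openConn a b)ᶜ ∨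
                ((prodBernoulli w).real (openConn a' b)ᶜ = (prodBernoulli w).real (openConn a b)ᶜ ∧ a' ≤ a))} := by
  intro n w A o b x _hoA _hbA _hxA hrel hdisj
  refine gl3OfReliableSource_arith A _ _ hdisj hrel (fun _ => measureReal_nonneg) ?_ ?_
  · -- the selection events partition `F`
    exact maxattOfGl3_real_setOf_exists_eq_sum (prodBernoulli w) A
      (fun a => (openConnIn (insert a ((↑(insert x (insert b A)) : Set (Fin n))ᶜ)) o a :
        Set (BondConfig (Fin n))))
      (fun a => (prodBernoulli w).real (openConn a b)ᶜ)
  · -- Kozma–Nitzan Lemma 3(i) with `a₁ = x`, `a₂ = o`, `Q = F`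
    intro d hd hle
    exact knLemma3i n w x o b _ d
      (gl3OfReliableSource_mono_openEdgeCluster A
        (fun a => insert a ((↑(insert x (insert b A)) : Set (Fin n))ᶜ)) o) hd hle

end Summit.CriticalPhenomena.PercolationContinuityZ3.Theorems
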